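import Summits.MatrixMultiplication.MatrixMultiplication.Theorems.AbelianSTPPCensusTAStatDDefs

/-!
# T_A certificate, fourth range `6191 … 6379` (static t*-indexed linear checker, free budget parameter, two-member fallback): kernel evaluation, shape checks, volumes `972 … 1579`

Cell mm-stpp (rung F-M1), threshold T_A = `τ = 2.371`; checker in `AbelianSTPPCensusTAStatDDefs.lean`, table in `AbelianSTPPCensusTAStatDData.lean`.
`decide` with kernel reduction (standard axioms; no `native_decide`), `Elab.async false`; consumed by `TAStatD.checkV_sound` / `TAStatD.domV_sound` / `TAStatD.m2V_sound`
in the leaf `AbelianSTPPCensusLeafTA6379Closed.lean`.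
WHAT THIS IS NOT: arithmetic on shape lists only; no statement about STPP families or `ω`.
-/

set_option linter.dupNamespace false
set_option autoImplicit false
set_option Elab.async false

namespace Summit.MatrixMultiplication.MatrixMultiplication.Theorems.TAStatD

set_option maxHeartbeats 0 in
/-- Check chunk: every sorted candidate shape of the volumes `972 … 1131` passes `checkShape` (44973 (shape, bucket) checks). [original] -/
theorem ck972 : TAStatD.checkV 160 972 = true := by decide +kernel

set_option maxHeartbeats 0 in
/-- Check chunk: every sorted candidate shape of the volumes `1132 … 1287` passes `checkShape` (44809 (shape, bucket) checks). [original] -/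
theorem ck1132 : TAStatD.checkV 156 1132 = true := by decide +kernel

set_option maxHeartbeats 0 in
/-- Check chunk: every sorted candidate shape of the volumes `1288 … 1434` passes `checkShape` (44887 (shape, bucket) checks). [original] -/
theorem ck1288 : TAStatD.checkV 147 1288 = true := by decide +kernel

set_option maxHeartbeats 0 in
/-- Check chunk: every sorted candidate shape of the volumes `1435 … 1579` passes `checkShape` (44821 (shape, bucket) checks). [original] -/
theorem ck1435 : TAStatD.checkV 145 1435 = true := by decide +kernel

end Summit.MatrixMultiplication.MatrixMultiplication.Theorems.TAStatD
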